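import Mathlib
import Literature.Analysis.FluidPDE.ClassicalSolution
import Literature.Analysis.FluidPDE.LerayHopf
import Literature.Analysis.FluidPDE.TaoLocalisationHolds
import Literature.Analysis.FluidPDE.KNSSTypeIIHolds
import Summits.NavierStokesRegularity.NavierStokesRegularity.Theses.PlaneEnergyCeiling
import Summits.NavierStokesRegularity.NavierStokesRegularity.Theorems.PlaneEnergyCeilingPlanarEnergyAPrioriPlanarAgmon

/-!
# Route PlaneEnergyCeiling · crux `PlanarEnergyAPriori` — the ceiling on closed slabs, under a
# smooth extension, and from NoBlowup; failure of the ceiling forces velocity blow-up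

Helper file for the crux item stmt-NavierStokesRegularity-16855 (`PlanarEnergyAPriori`, route
`PlaneEnergyCeiling`), landed `--supports` that item. The crux asks, along every classical
solution `(u,p)` of unforced Navier–Stokes on `ℝ³ × [0,T)` that is Leray–Hopf from a rapidly
decaying datum, for ONE bound on the planar kinetic energies
`E(u(t);R,c) = ∫_{R({x₂=c})} |u(t)|² dA` over all `t < T`, all linear isometries `R` and all
offsets `c`. This file settles everything except the behaviour at the final time `T`
(strategist census `Cruxes/PlanarEnergyAPriori/STRATEGY-CENSUS.md`, items D2/D3, WITHOUT the
pointwise decay persistence of the line `birth`):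

* `planarCeiling_of_hasBoundedSobolevNormsOn` — kinematics: on a time set where the `H¹` norms
  (`HasBoundedSobolevNormsOn`, order `1`) and the energies are bounded, the planar energies are
  bounded, by the planar Agmon inequality `E² ≤ ‖u(t)‖₂² ‖∇u(t)‖₂²`
  (`planarEnergy_sq_le_lintegral_mul_lintegral_fderiv'`, landed);
* `planarCeiling_closedSlab` — along a solution of the crux's class the planar energies are
  bounded on every CLOSED slab `[0,T₁]`, `T₁ < T` (Tao 2013, Cor. 11.1 + Cor. 4.3 + Thm. 5.4 (iv):
  `u ∈ L^∞_t H^k_x` on closed slabs, in tree as `tao2011_hasBoundedSobolevNormsOn_holds`; energy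
  by the Leray–Hopf inequality); hence the crux is equivalent to a bound on any final stretch
  `[T₁,T)` (`planarCeiling_of_tail`);
* `planarCeiling_of_hasSmoothExtensionPast` — if `u` extends as a classical solution past `T`,
  the crux's conclusion holds on `[0,T)` (the extension has finite energy at `t = T` by Fatou,
  so Tao's theorem applies on the closed slab `[0,T]`);
* `planarEnergyAPriori_of_noBlowup` — consequently NoBlowup (the signature of
  stmt-NavierStokesRegularity-0054: every such solution extends smoothly past every `T`) implies
  the crux: `PlanarEnergyAPriori` is NSR-necessary, formally;
* `exists_norm_gt_of_not_planarCeiling` — if the ceiling fails on `[0,T)` then `u` is unbounded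
  on `[0,T) × ℝ³` (bounded Leray–Hopf classical solutions continue, Robinson–Rodrigo–Sadowski
  2016 Thm. 8.17, in tree as `hasSmoothExtensionPast_of_bounded_holds`): the content of the crux
  sits exactly at a velocity blow-up time.

References: Tao, *Localisation and compactness properties of the Navier–Stokes global
regularity problem*, Anal. PDE 6 (2013), Cor. 11.1; Robinson–Rodrigo–Sadowski 2016, Thm. 8.17;
Agmon's inequality (Lemarié-Rieusset 2016, Ch. 11–12). [Tao2011] [RobinsonRodrigoSadowski2016]
-/

noncomputable section

-- single-conjunct summit: `Summit.<Summit>.<Problem>` repeats the name by the D-0017 layout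
set_option linter.dupNamespace false

namespace Summit.NavierStokesRegularity.NavierStokesRegularity.Theorems.PlanarEnergyAPriori

open MeasureTheory Set Filter Topology Function WithLp
open scoped ENNReal NNReal
open Literature.Analysis.FluidPDE

variable {ν T : ℝ} {u : ℝ → EuclideanSpace ℝ (Fin 3) → EuclideanSpace ℝ (Fin 3)}
  {p : ℝ → EuclideanSpace ℝ (Fin 3) → ℝ}

/-! ### Kinematics: bounded `H¹` norm and bounded energy bound the planar energies -/

/-- The order-one case of the Beale–Kato–Majda class: `HasBoundedSobolevNormsOn S u` bounds
`∫ ‖∇u(t)‖²` uniformly in `t ∈ S` (`‖D¹f(x)‖ = ‖fderiv f x‖`). -/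
theorem exists_lintegral_enorm_fderiv_sq_le_of_hasBoundedSobolevNormsOn {S : Set ℝ}
    (hH : HasBoundedSobolevNormsOn S u) :
    ∃ C : ℝ≥0, ∀ t ∈ S, ∫⁻ x, ‖fderiv ℝ (u t) x‖ₑ ^ 2 ≤ C := by
  obtain ⟨C, hC⟩ := hH 1
  refine ⟨C, fun t ht => ?_⟩
  have h1 : ∀ x, ‖fderiv ℝ (u t) x‖ₑ = ‖iteratedFDeriv ℝ 1 (u t) x‖ₑ := fun x => by
    rw [← ofReal_norm, ← ofReal_norm, norm_iteratedFDeriv_one]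
  simp_rw [h1]
  exact hC t ht

/-- From `E² ≤ K·C` to `E ≤ √(K·C)` in `ℝ≥0∞` (finite `K`, `C`). -/
theorem le_ofReal_sqrt_of_sq_le {E K : ℝ≥0∞} {C : ℝ≥0} (hK : K ≠ ⊤) (h : E ^ 2 ≤ K * C) :
    E ≤ ENNReal.ofReal (Real.sqrt (K.toReal * C)) := by
  rw [← ENNReal.pow_le_pow_left_iff two_ne_zero]
  refine h.trans (le_of_eq ?_)
  rw [← ENNReal.ofReal_pow (Real.sqrt_nonneg _),
    Real.sq_sqrt (by positivity), ENNReal.ofReal_mul ENNReal.toReal_nonneg,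
    ENNReal.ofReal_toReal hK, ENNReal.ofReal_coe_nnreal]

/-- **Planar ceiling from bounded `H¹` norms and bounded energy (kinematic).** If on a time set
`S` every slice `u t` is `C¹`, the Sobolev norms are bounded (`HasBoundedSobolevNormsOn S u`; only
order `1` is used) and the energies are bounded by a finite `K`, then the planar energies
`E(u(t);R,c)` are bounded uniformly in `t ∈ S`, `R`, `c` — planar Agmon:
`E² ≤ ‖u(t)‖₂² ‖∇u(t)‖₂² ≤ K·C`. [folklore] -/
theorem planarCeiling_of_hasBoundedSobolevNormsOn {S : Set ℝ} (hC1 : ∀ t ∈ S, ContDiff ℝ 1 (u t))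
    (hH : HasBoundedSobolevNormsOn S u) {K : ℝ≥0∞} (hK : K ≠ ⊤)
    (hE : ∀ t ∈ S, ∫⁻ x, ‖u t x‖ₑ ^ 2 ≤ K) :
    ∃ M : ℝ, ∀ t ∈ S, ∀ (R : EuclideanSpace ℝ (Fin 3) ≃ₗᵢ[ℝ] EuclideanSpace ℝ (Fin 3)) (c : ℝ),
      ∫⁻ y : EuclideanSpace ℝ (Fin 2), ‖u t (R (toLp 2 ![y 0, y 1, c]))‖ₑ ^ 2 ≤ ENNReal.ofReal M := by
  obtain ⟨C, hC⟩ := exists_lintegral_enorm_fderiv_sq_le_of_hasBoundedSobolevNormsOn hH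
  refine ⟨Real.sqrt (K.toReal * C), fun t ht R c => le_ofReal_sqrt_of_sq_le hK ?_⟩
  have hL2 : ∫⁻ x, ‖u t x‖ₑ ^ 2 < ∞ := (hE t ht).trans_lt (lt_top_iff_ne_top.2 hK)
  exact (planarEnergy_sq_le_lintegral_mul_lintegral_fderiv' (hC1 t ht) hL2 R c).trans
    (mul_le_mul' (hE t ht) (hC t ht))

/-! ### The ceiling on closed slabs `[0,T₁]`, `T₁ < T` -/

/-- **Planar ceiling on closed slabs.** Along a classical solution of unforced Navier–Stokes on
`[0,T)` (`ν > 0`) that is Leray–Hopf from its rapidly decaying datum `u 0`, the planar kinetic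
energies are bounded on every closed slab `[0,T₁]`, `0 < T₁ < T`, uniformly in `t`, `R`, `c`:
Tao 2013 (Cor. 11.1 + Cor. 4.3 + Thm. 5.4 (iv), `tao2011_hasBoundedSobolevNormsOn_holds`) bounds
all Sobolev norms on the closed slab (its energy being bounded by the Leray–Hopf inequality),
and the planar Agmon inequality converts `H¹` + energy into planar bounds. [cite: Tao2011, Cor. 11.1 + Cor. 4.3 + Thm. 5.4 (iv)] -/
theorem planarCeiling_closedSlab (hν : 0 < ν) (hcl : IsClassicalNSSolutionOn (Ico 0 T) ν 0 u p)
    (hLH : IsLerayHopfOn T ν 0 (u 0) u) (hdec : HasRapidSpatialDecay (u 0)) {T₁ : ℝ}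
    (hT₁ : T₁ ∈ Ioo 0 T) :
    ∃ M : ℝ, ∀ t ∈ Icc 0 T₁, ∀ (R : EuclideanSpace ℝ (Fin 3) ≃ₗᵢ[ℝ] EuclideanSpace ℝ (Fin 3)) (c : ℝ),
      ∫⁻ y : EuclideanSpace ℝ (Fin 2), ‖u t (R (toLp 2 ![y 0, y 1, c]))‖ₑ ^ 2 ≤ ENNReal.ofReal M := by
  have hcl' : IsClassicalNSSolutionOn (Icc 0 T₁) ν 0 u p :=
    hcl.mono (Icc_subset_Ico_right hT₁.2) (uniqueDiffOn_Icc hT₁.1)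
  set K : ℝ≥0∞ := ENNReal.ofReal (2 * VectorCalculus.kineticEnergy (u 0)) with hK
  have hE : ∀ t ∈ Icc 0 T₁, ∫⁻ x, ‖u t x‖ₑ ^ 2 ≤ K := fun t ht =>
    hLH.lintegral_enorm_sq_le hν.le ⟨ht.1, ht.2.trans hT₁.2.le⟩
  have hE' : ∃ C : ℝ≥0, ∀ t ∈ Icc 0 T₁, ∫⁻ x, ‖u t x‖ₑ ^ 2 ≤ C :=
    ⟨(2 * VectorCalculus.kineticEnergy (u 0)).toNNReal, hE⟩
  have hH : HasBoundedSobolevNormsOn (Icc 0 T₁) u :=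
    tao2011_hasBoundedSobolevNormsOn_holds hν hT₁.1 hcl' hE' hdec
  exact planarCeiling_of_hasBoundedSobolevNormsOn
    (fun t ht => (hcl'.contDiff_velocity ht).of_le (by exact_mod_cast le_top)) hH
    ENNReal.ofReal_ne_top hE

/-- **The crux is a statement about the final stretch.** Along a solution of the crux's class, a
planar bound on some final stretch `[T₁,T)`, `T₁ < T`, already gives the bound on all of `[0,T)`
(the closed slab `[0,T₁]` is covered by `planarCeiling_closedSlab`). [folklore] -/
theorem planarCeiling_of_tail (hν : 0 < ν) (hcl : IsClassicalNSSolutionOn (Ico 0 T) ν 0 u p)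
    (hLH : IsLerayHopfOn T ν 0 (u 0) u) (hdec : HasRapidSpatialDecay (u 0)) {T₁ : ℝ} (hT₁ : T₁ < T)
    (htail : ∃ M : ℝ, ∀ t ∈ Ico T₁ T,
      ∀ (R : EuclideanSpace ℝ (Fin 3) ≃ₗᵢ[ℝ] EuclideanSpace ℝ (Fin 3)) (c : ℝ),
        ∫⁻ y : EuclideanSpace ℝ (Fin 2), ‖u t (R (toLp 2 ![y 0, y 1, c]))‖ₑ ^ 2 ≤ ENNReal.ofReal M) :
    ∃ M : ℝ, ∀ t ∈ Ico 0 T, ∀ (R : EuclideanSpace ℝ (Fin 3) ≃ₗᵢ[ℝ] EuclideanSpace ℝ (Fin 3)) (c : ℝ),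
      ∫⁻ y : EuclideanSpace ℝ (Fin 2), ‖u t (R (toLp 2 ![y 0, y 1, c]))‖ₑ ^ 2 ≤ ENNReal.ofReal M := by
  obtain ⟨M₂, hM₂⟩ := htail
  rcases le_or_gt T₁ 0 with h0 | h0
  · exact ⟨M₂, fun t ht R c => hM₂ t ⟨h0.trans ht.1, ht.2⟩ R c⟩
  · obtain ⟨M₁, hM₁⟩ := planarCeiling_closedSlab hν hcl hLH hdec ⟨h0, hT₁⟩
    refine ⟨max M₁ M₂, fun t ht R c => ?_⟩
    rcases le_or_gt t T₁ with h1 | h1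
    · exact (hM₁ t ⟨ht.1, h1⟩ R c).trans (ENNReal.ofReal_le_ofReal (le_max_left _ _))
    · exact (hM₂ t ⟨h1.le, ht.2⟩ R c).trans (ENNReal.ofReal_le_ofReal (le_max_right _ _))

/-! ### Under a smooth extension past `T` -/

/-- **Finite energy at the final time of an extension (Fatou).** If `u'` is jointly smooth on
`[0,T') × ℝ³`, `0 < T < T'`, and its slices have energy `≤ K` on `[0,T)`, then so does the slice
at `t = T`: `∫ |u'(T)|² ≤ liminf_{t↑T} ∫ |u'(t)|² ≤ K`. [folklore] -/
theorem lintegral_enorm_sq_le_of_extension {T' : ℝ}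
    {u' : ℝ → EuclideanSpace ℝ (Fin 3) → EuclideanSpace ℝ (Fin 3)}
    (hsm : IsSmoothSpaceTimeOn (Ico 0 T') u') (hT : 0 < T) (hTT' : T < T') {K : ℝ≥0∞}
    (hE : ∀ t ∈ Ico 0 T, ∫⁻ x, ‖u' t x‖ₑ ^ 2 ≤ K) :
    ∫⁻ x, ‖u' T x‖ₑ ^ 2 ≤ K := by
  -- times `tₙ = T − T/(n+2) ↑ T` inside `[0,T)`
  set tn : ℕ → ℝ := fun n => T - T / ((n : ℝ) + 2) with htn
  have hpos : ∀ n : ℕ, 0 < (n : ℝ) + 2 := fun n => by positivity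
  have hmem : ∀ n, tn n ∈ Ico 0 T := fun n => by
    refine ⟨?_, ?_⟩
    · have h1 : T / ((n : ℝ) + 2) ≤ T := by
        rw [div_le_iff₀ (hpos n)]
        nlinarith
      simp only [htn]
      linarith
    · have h1 : 0 < T / ((n : ℝ) + 2) := div_pos hT (hpos n)
      simp only [htn]
      linarith
  have htend : Tendsto tn atTop (𝓝 T) := by
    have h1 : Tendsto (fun n : ℕ => T / ((n : ℝ) + 2)) atTop (𝓝 0) :=
      tendsto_const_nhds.div_atTop
        (tendsto_atTop_add_const_right _ _ tendsto_natCast_atTop_atTop)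
    simpa using (tendsto_const_nhds (x := T)).sub h1
  -- pointwise convergence of the integrands by joint continuity
  have hcont : ContinuousOn (uncurry u') (Ico 0 T' ×ˢ univ) := hsm.continuousOn
  have hlim : ∀ x, Tendsto (fun n => ‖u' (tn n) x‖ₑ ^ 2) atTop (𝓝 (‖u' T x‖ₑ ^ 2)) := by
    intro x
    have hTmem : (T, x) ∈ Ico 0 T' ×ˢ (univ : Set (EuclideanSpace ℝ (Fin 3))) :=
      ⟨⟨hT.le, hTT'⟩, mem_univ _⟩
    have h1 : Tendsto (fun n => (tn n, x)) atTop (𝓝[Ico 0 T' ×ˢ univ] (T, x)) :=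
      tendsto_nhdsWithin_iff.2 ⟨htend.prodMk_nhds tendsto_const_nhds,
        Eventually.of_forall fun n => ⟨⟨(hmem n).1, (hmem n).2.trans hTT'⟩, mem_univ _⟩⟩
    have h2 : Tendsto (fun n => u' (tn n) x) atTop (𝓝 (u' T x)) :=
      ((hcont.continuousWithinAt hTmem).tendsto.comp h1)
    exact ((ENNReal.continuous_pow 2).tendsto _).comp h2.enorm
  have hmeas : ∀ n, Measurable fun x => ‖u' (tn n) x‖ₑ ^ 2 := fun n =>
    ((hsm.contDiff_slice ⟨(hmem n).1, (hmem n).2.trans hTT'⟩).continuous.measurable.enorm.pow_const 2)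
  calc ∫⁻ x, ‖u' T x‖ₑ ^ 2 = ∫⁻ x, liminf (fun n => ‖u' (tn n) x‖ₑ ^ 2) atTop :=
        lintegral_congr fun x => ((hlim x).liminf_eq).symm
    _ ≤ liminf (fun n => ∫⁻ x, ‖u' (tn n) x‖ₑ ^ 2) atTop := lintegral_liminf_le hmeas
    _ ≤ K := liminf_le_of_frequently_le' (Eventually.of_forall fun n => hE (tn n) (hmem n)).frequently

/-- **Planar ceiling under a smooth extension past `T`.** If a classical solution of unforced
Navier–Stokes on `[0,T)` (`ν > 0`, `T > 0`), Leray–Hopf from its rapidly decaying datum, extends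
as a classical solution past `T` (`HasSmoothExtensionPast ν 0 u T`), then its planar kinetic
energies are bounded on `[0,T)` uniformly in `t`, `R`, `c`: the extension is classical on the
CLOSED slab `[0,T]` with finite energy there (Leray–Hopf on `[0,T)`, Fatou at `t = T`) and
rapidly decaying datum, so Tao 2013 bounds its Sobolev norms on `[0,T]`, and planar Agmon
concludes. [cite: Tao2011, Cor. 11.1 + Cor. 4.3 + Thm. 5.4 (iv)] -/
theorem planarCeiling_of_hasSmoothExtensionPast (hν : 0 < ν) (hT : 0 < T)
    (hcl : IsClassicalNSSolutionOn (Ico 0 T) ν 0 u p) (hLH : IsLerayHopfOn T ν 0 (u 0) u)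
    (hdec : HasRapidSpatialDecay (u 0)) (hext : HasSmoothExtensionPast ν 0 u T) :
    ∃ M : ℝ, ∀ t ∈ Ico 0 T, ∀ (R : EuclideanSpace ℝ (Fin 3) ≃ₗᵢ[ℝ] EuclideanSpace ℝ (Fin 3)) (c : ℝ),
      ∫⁻ y : EuclideanSpace ℝ (Fin 2), ‖u t (R (toLp 2 ![y 0, y 1, c]))‖ₑ ^ 2 ≤ ENNReal.ofReal M := by
  have _ := hcl
  obtain ⟨T', hTT', u', p', hcl', hagree⟩ := hext
  have hclT : IsClassicalNSSolutionOn (Icc 0 T) ν 0 u' p' :=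
    hcl'.mono (Icc_subset_Ico_right hTT') (uniqueDiffOn_Icc hT)
  set K : ℝ≥0∞ := ENNReal.ofReal (2 * VectorCalculus.kineticEnergy (u 0)) with hK
  -- energy of the extension on `[0,T)` (agreement with `u`) and at `t = T` (Fatou)
  have hE₀ : ∀ t ∈ Ico 0 T, ∫⁻ x, ‖u' t x‖ₑ ^ 2 ≤ K := fun t ht => by
    rw [hagree t ht]
    exact hLH.lintegral_enorm_sq_le hν.le ⟨ht.1, ht.2.le⟩
  have hET : ∫⁻ x, ‖u' T x‖ₑ ^ 2 ≤ K :=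
    lintegral_enorm_sq_le_of_extension hcl'.smooth_velocity hT hTT' hE₀
  have hE : ∀ t ∈ Icc 0 T, ∫⁻ x, ‖u' t x‖ₑ ^ 2 ≤ K := fun t ht => by
    rcases ht.2.eq_or_lt with h | h
    · rw [h]; exact hET
    · exact hE₀ t ⟨ht.1, h⟩
  have hE' : ∃ C : ℝ≥0, ∀ t ∈ Icc 0 T, ∫⁻ x, ‖u' t x‖ₑ ^ 2 ≤ C :=
    ⟨(2 * VectorCalculus.kineticEnergy (u 0)).toNNReal, hE⟩
  have hdec' : HasRapidSpatialDecay (u' 0) := by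
    rw [hagree 0 ⟨le_rfl, hT⟩]
    exact hdec
  have hH : HasBoundedSobolevNormsOn (Icc 0 T) u' :=
    tao2011_hasBoundedSobolevNormsOn_holds hν hT hclT hE' hdec'
  obtain ⟨M, hM⟩ := planarCeiling_of_hasBoundedSobolevNormsOn
    (fun t ht => (hclT.contDiff_velocity ht).of_le (by exact_mod_cast le_top)) hH
    ENNReal.ofReal_ne_top hE
  refine ⟨M, fun t ht R c => ?_⟩
  rw [← hagree t ht]
  exact hM t (Ico_subset_Icc_self ht) R c

/-- **NoBlowup ⇒ the crux.** If every classical solution of unforced Navier–Stokes on `[0,T)`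
(`ν > 0`, `T > 0`) that is Leray–Hopf from a rapidly decaying datum extends smoothly past `T` —
verbatim the NoBlowup statement stmt-NavierStokesRegularity-0054 shared by the routes
`TypeILiouville`, `StretchingWellBinding`, … — then `PlanarEnergyAPriori` holds: the planar
energy ceiling is NSR-necessary (strategist census D2, here without pointwise decay
persistence). [folklore] -/
theorem planarEnergyAPriori_of_noBlowup
    (h : ∀ (ν T : ℝ), 0 < ν → 0 < T →
      ∀ (u : ℝ → EuclideanSpace ℝ (Fin 3) → EuclideanSpace ℝ (Fin 3))
        (p : ℝ → EuclideanSpace ℝ (Fin 3) → ℝ),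
        Literature.Analysis.FluidPDE.IsClassicalNSSolutionOn (Set.Ico 0 T) ν 0 u p →
        Literature.Analysis.FluidPDE.IsLerayHopfOn T ν 0 (u 0) u →
        Literature.Analysis.FluidPDE.HasRapidSpatialDecay (u 0) →
        Literature.Analysis.FluidPDE.HasSmoothExtensionPast ν 0 u T) :
    Summit.NavierStokesRegularity.NavierStokesRegularity.Theses.PlaneEnergyCeiling.PlanarEnergyAPriori :=
  fun ν T hν hT u p hcl hLH hdec =>
    planarCeiling_of_hasSmoothExtensionPast hν hT hcl hLH hdec (h ν T hν hT u p hcl hLH hdec)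

/-! ### Failure of the ceiling forces velocity blow-up -/

/-- **No planar ceiling ⇒ no smooth extension.** If the planar energies of a solution of the
crux's class are NOT bounded on `[0,T)`, the solution does not extend smoothly past `T`
(contrapositive of `planarCeiling_of_hasSmoothExtensionPast`). [folklore] -/
theorem not_hasSmoothExtensionPast_of_not_planarCeiling (hν : 0 < ν) (hT : 0 < T)
    (hcl : IsClassicalNSSolutionOn (Ico 0 T) ν 0 u p) (hLH : IsLerayHopfOn T ν 0 (u 0) u)
    (hdec : HasRapidSpatialDecay (u 0))
    (hfail : ¬ ∃ M : ℝ, ∀ t ∈ Ico 0 T,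
      ∀ (R : EuclideanSpace ℝ (Fin 3) ≃ₗᵢ[ℝ] EuclideanSpace ℝ (Fin 3)) (c : ℝ),
        ∫⁻ y : EuclideanSpace ℝ (Fin 2), ‖u t (R (toLp 2 ![y 0, y 1, c]))‖ₑ ^ 2 ≤ ENNReal.ofReal M) :
    ¬ HasSmoothExtensionPast ν 0 u T := fun hext =>
  hfail (planarCeiling_of_hasSmoothExtensionPast hν hT hcl hLH hdec hext)

/-- **No planar ceiling ⇒ the velocity is unbounded on `[0,T) × ℝ³`** (strategist census D3):
a classical Leray–Hopf solution bounded up to the final time continues past it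
(Robinson–Rodrigo–Sadowski 2016 Thm. 8.17, `hasSmoothExtensionPast_of_bounded_holds`), and a
continued solution has a planar ceiling (`planarCeiling_of_hasSmoothExtensionPast`). So the
content of the crux `PlanarEnergyAPriori` sits exactly at a velocity blow-up time. [cite: RobinsonRodrigoSadowski2016, Thm 8.17] -/
theorem exists_norm_gt_of_not_planarCeiling (hν : 0 < ν) (hT : 0 < T)
    (hcl : IsClassicalNSSolutionOn (Ico 0 T) ν 0 u p) (hLH : IsLerayHopfOn T ν 0 (u 0) u)
    (hdec : HasRapidSpatialDecay (u 0))
    (hfail : ¬ ∃ M : ℝ, ∀ t ∈ Ico 0 T,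
      ∀ (R : EuclideanSpace ℝ (Fin 3) ≃ₗᵢ[ℝ] EuclideanSpace ℝ (Fin 3)) (c : ℝ),
        ∫⁻ y : EuclideanSpace ℝ (Fin 2), ‖u t (R (toLp 2 ![y 0, y 1, c]))‖ₑ ^ 2 ≤ ENNReal.ofReal M) :
    ∀ K : ℝ, ∃ t ∈ Ico 0 T, ∃ x, K < ‖u t x‖ := by
  by_contra hb
  push Not at hb
  obtain ⟨K, hK⟩ := hb
  exact not_hasSmoothExtensionPast_of_not_planarCeiling hν hT hcl hLH hdec hfail
    (hasSmoothExtensionPast_of_bounded_holds hν hT hcl hLH ⟨K, hK⟩)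

/-- **Registered-shape corollary: the crux on closed sub-slabs.** For `ν > 0`, `T > 0` and every
classical solution of unforced Navier–Stokes on `[0,T)` that is Leray–Hopf from a rapidly
decaying datum, and every `T₁ < T`, the planar kinetic energies are bounded on `[0,T₁]`
uniformly in `t`, `R`, `c` (the crux `PlanarEnergyAPriori` with `Ico 0 T` replaced by
`Icc 0 T₁`). [cite: Tao2011, Cor. 11.1 + Cor. 4.3 + Thm. 5.4 (iv)] -/
theorem planarEnergyAPriori_closedSlab :
    ∀ (ν T : ℝ), 0 < ν → 0 < T →
      ∀ (u : ℝ → EuclideanSpace ℝ (Fin 3) → EuclideanSpace ℝ (Fin 3))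
        (p : ℝ → EuclideanSpace ℝ (Fin 3) → ℝ),
        Literature.Analysis.FluidPDE.IsClassicalNSSolutionOn (Set.Ico 0 T) ν 0 u p →
        Literature.Analysis.FluidPDE.IsLerayHopfOn T ν 0 (u 0) u →
        Literature.Analysis.FluidPDE.HasRapidSpatialDecay (u 0) →
        ∀ T₁ < T, ∃ M : ℝ, ∀ t ∈ Set.Icc 0 T₁,
          ∀ (R : EuclideanSpace ℝ (Fin 3) ≃ₗᵢ[ℝ] EuclideanSpace ℝ (Fin 3)) (c : ℝ),
            ∫⁻ y : EuclideanSpace ℝ (Fin 2), ‖u t (R (WithLp.toLp 2 ![y 0, y 1, c]))‖ₑ ^ 2 ≤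
              ENNReal.ofReal M := by
  intro ν T hν hT u p hcl hLH hdec T₁ hT₁
  -- enlarge `T₁` to a positive time `T₂ = max T₁ (T/2) < T`
  have hT₂ : max T₁ (T / 2) ∈ Ioo 0 T :=
    ⟨lt_max_of_lt_right (half_pos hT), max_lt hT₁ (half_lt_self hT)⟩
  obtain ⟨M, hM⟩ := planarCeiling_closedSlab hν hcl hLH hdec hT₂
  exact ⟨M, fun t ht R c => hM t ⟨ht.1, ht.2.trans (le_max_left _ _)⟩ R c⟩

end Summit.NavierStokesRegularity.NavierStokesRegularity.Theorems.PlanarEnergyAPriori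

end
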